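import Summits.QuantumFields.YangMills.Theorems.LuscherReductionDressedRitzLiftLeakageForms
import HarnessLib

/-!
# Crux `DressedRitz` (stmt-QuantumFields-20205), line «polyakovlift» r5, stub S-LEAK `stub_liftLeakage` — support XI-a:
# operator-free layer of the TIME-DRESSING bookkeeping for (o4): iterates of an `ip`-symmetric `K` against exact eigenvectors

Support module (fleet seat ym-20205-polyakovlift-s1 gen 1; `--supports stmt-QuantumFields-20205`, helper, no closure claim) for the registered stub
`Summit.QuantumFields.YangMills.Cruxes.DressedRitz.PolyakovLift.stub_liftLeakage` of skeleton r5 (clause (o4) for the TIME-DRESSED lifted channel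
vectors `u = K_β^[m] x`, `m = dressSteps L`; tree `…PolyakovLiftDressed.lean`, p529179).  This file is the ABSTRACT layer, in the operator-free
language of support I (`…LiftLeakageForms.lean`: a real vector space `D`, a symmetric bilinear `ip`, an `ip`-symmetric linear `K`, `ip`-orthonormal
exact eigenvectors `e_j` with `K e_j = λ_j e_j`); the femto instantiation and the press-buttons in the stub's currency are support XI-b
(`…LiftLeakageDressedSectors.lean`).  No definition is introduced.

* `ip_iterate_eigen` — `ip(K^[m]x, e_j) = λ_j^m ip(x,e_j)`; `iterate_eigen`, `iterate_map_sub`, `iterate_sum_smul_eigen` (linearity of `K^[m]`);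
* `iterate_remainder` — the remainder of `K^[m]x` after removing its `e`-components IS `K^[m]r`, `r = x − Σ_j ip(x,e_j)e_j` the remainder of `x`;
* `norm_split` — Pythagoras `ip(x,x) = Σ_j ip(x,e_j)² + ip(r,r)`;
* ★ `residual_iterate_split` — `ip((K−a)K^[m]x, (K−a)K^[m]x) = Σ_j (λ_j − a)²·λ_j^{2m}·ip(x,e_j)² + ip((K−a)K^[m]r, (K−a)K^[m]r)` (EXACT: the dressing
  reweights level `j` by `λ_j^{2m}`, no cross term);
* `normSq_iterate_split` — `ip(K^[m]x, K^[m]x) = Σ_j λ_j^{2m} ip(x,e_j)² + ip(K^[m]r, K^[m]r)`;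
* on a `K`-stable class `P` dominated by `Λ ≥ 0` (`0 ≤ ip(y,Ky) ≤ Λ ip(y,y)`, `ip ≥ 0`): `iterate_mem_of_stable`, `normSq_iterate_dom_le` —
  `ip(K^[m]r,K^[m]r) ≤ Λ^{2m} ip(r,r)`, ★ `residual_iterate_remainder_le` — `ip((K−a)K^[m]r,(K−a)K^[m]r) ≤ max(a²,(Λ−a)²)·Λ^{2m}·ip(r,r)`.

HONEST FRAMING: linear algebra; the stub `stub_liftLeakage` stays OPEN; nothing here bears on infinite volume, the continuum limit or the Clay gap.
References: T. Kato, J. Phys. Soc. Japan 4 (1949) 334 [cite: Kato1949, §1]; M. Reed, B. Simon IV (1978) Thm XIII.1 [cite: ReedSimonIV1978];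
M. Lüscher, U. Wolff, NPB 339 (1990) 222 [cite: LuscherWolff1990, §2].
-/

set_option autoImplicit false

noncomputable section

open Finset
open Literature.Analysis.OperatorTheory
open scoped BigOperators

namespace Summit.QuantumFields.YangMills.Theorems.FemtoTransferGap.LiftLeak

/-! ## §A Operator-free layer: iterates against exact eigenvectors -/

section Abstract

variable {D : Type*} [AddCommGroup D] [Module ℝ D]

/-- `ip(K^[m] x, e) = μ^m · ip(x, e)` for an `ip`-symmetric `K` and an exact eigenvector `K e = μ e`. [cite: ReedSimonIV1978, Thm XIII.1] -/
theorem ip_iterate_eigen (ip : D →ₗ[ℝ] D →ₗ[ℝ] ℝ) (K : D →ₗ[ℝ] D) (hK : ∀ x y, ip (K x) y = ip x (K y))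
    {e : D} {μ : ℝ} (heig : K e = μ • e) (x : D) (m : ℕ) :
    ip ((K : D → D)^[m] x) e = μ ^ m * ip x e := by
  induction m with
  | zero => simp
  | succ m ih =>
    rw [Function.iterate_succ_apply', hK, heig, map_smul, smul_eq_mul, ih, pow_succ]
    ring

/-- `K^[m]` applied to an exact eigenvector: `K^[m] e = μ^m • e`. [folklore] -/
theorem iterate_eigen (K : D →ₗ[ℝ] D) {e : D} {μ : ℝ} (heig : K e = μ • e) (m : ℕ) :
    (K : D → D)^[m] e = μ ^ m • e := by
  induction m with
  | zero => simp
  | succ m ih => rw [Function.iterate_succ_apply', ih, map_smul, heig, smul_smul, pow_succ, mul_comm]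

/-- `K^[m]` is additive (it is the linear map `K^m`). [folklore] -/
theorem iterate_map_sub (K : D →ₗ[ℝ] D) (x y : D) (m : ℕ) :
    (K : D → D)^[m] (x - y) = (K : D → D)^[m] x - (K : D → D)^[m] y := by
  induction m with
  | zero => simp
  | succ m ih => rw [Function.iterate_succ_apply', ih, map_sub, ← Function.iterate_succ_apply' K m x, ← Function.iterate_succ_apply' K m y]

/-- `K^[m]` of a finite combination of exact eigenvectors: `K^[m] (Σ_j c_j • e_j) = Σ_j (c_j μ_j^m) • e_j`. [folklore] -/
theorem iterate_sum_smul_eigen (K : D →ₗ[ℝ] D) {N : ℕ} (e : Fin N → D) (ev : Fin N → ℝ) (heig : ∀ j, K (e j) = ev j • e j)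
    (c : Fin N → ℝ) (m : ℕ) :
    (K : D → D)^[m] (∑ j, c j • e j) = ∑ j, (c j * ev j ^ m) • e j := by
  induction m with
  | zero => simp
  | succ m ih =>
    rw [Function.iterate_succ_apply', ih, map_sum]
    refine sum_congr rfl fun j _ => ?_
    rw [map_smul, heig, smul_smul, pow_succ]
    congr 1
    ring

/-- ★ **The remainder commutes with the dressing**: with `r = x − Σ_j ip(x,e_j) e_j`, the remainder of `K^[m] x` after removing ITS `e`-components is
`K^[m] r`: `K^[m]x − Σ_j ip(K^[m]x, e_j) e_j = K^[m] r`. [cite: ReedSimonIV1978, Thm XIII.1] -/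
theorem iterate_remainder (ip : D →ₗ[ℝ] D →ₗ[ℝ] ℝ) (K : D →ₗ[ℝ] D) (hK : ∀ x y, ip (K x) y = ip x (K y))
    {N : ℕ} (e : Fin N → D) (ev : Fin N → ℝ) (heig : ∀ j, K (e j) = ev j • e j) (x : D) (m : ℕ) :
    (K : D → D)^[m] x - ∑ j, ip ((K : D → D)^[m] x) (e j) • e j =
      (K : D → D)^[m] (x - ∑ j, ip x (e j) • e j) := by
  rw [iterate_map_sub, iterate_sum_smul_eigen K e ev heig]
  congr 1
  refine sum_congr rfl fun j _ => ?_
  rw [ip_iterate_eigen ip K hK (heig j), mul_comm]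

/-- **Pythagoras against orthonormal vectors**: `ip(x,x) = Σ_j ip(x,e_j)² + ip(r,r)`, `r = x − Σ_j ip(x,e_j)e_j` (`ip` symmetric). [folklore] -/
theorem norm_split (ip : D →ₗ[ℝ] D →ₗ[ℝ] ℝ) (hip : ∀ x y, ip x y = ip y x) {N : ℕ} (e : Fin N → D)
    (hon : ∀ i l, ip (e i) (e l) = if i = l then 1 else 0) (x : D) :
    ip x x = ∑ j, ip x (e j) ^ 2 + ip (x - ∑ j, ip x (e j) • e j) (x - ∑ j, ip x (e j) • e j) := by
  classical
  set r : D := x - ∑ j, ip x (e j) • e j with hr_def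
  set s : D := ∑ j, ip x (e j) • e j with hs_def
  have hr : ∀ l, ip r (e l) = 0 := ip_remainder_eq_zero ip e hon x
  have hx : x = s + r := by rw [hr_def]; abel
  have hsr : ip s r = 0 := by
    rw [hs_def, bilin_sum_smul_left]
    exact sum_eq_zero fun j _ => by rw [hip (e j) r, hr, mul_zero]
  have hrs : ip r s = 0 := by rw [hip]; exact hsr
  have hss : ip s s = ∑ j, ip x (e j) ^ 2 := by
    rw [hs_def, bilin_sum_smul_sum_smul]
    refine sum_congr rfl fun j _ => ?_
    simp only [hon, mul_ite, mul_one, mul_zero, Finset.sum_ite_eq, Finset.mem_univ, if_true]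
    ring
  conv_lhs => rw [hx]
  simp only [map_add, LinearMap.add_apply, hsr, hrs, hss, add_zero, zero_add]

/-- ★ **EXACT sector split of the dressed residual.**  `ip` symmetric, `K` `ip`-symmetric, `e_0 … e_{N−1}` `ip`-orthonormal exact eigenvectors
(`K e_j = λ_j e_j`).  For every `x`, `a`, `m`, with `r = x − Σ_j ip(x,e_j)e_j`:
`ip((K−a)K^[m]x, (K−a)K^[m]x) = Σ_j (λ_j − a)²·λ_j^{2m}·ip(x,e_j)² + ip((K−a)K^[m]r, (K−a)K^[m]r)` — the dressing reweights level `j` by `λ_j^{2m}`.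
[cite: ReedSimonIV1978, Thm XIII.1] [cite: LuscherWolff1990, §2] -/
theorem residual_iterate_split (ip : D →ₗ[ℝ] D →ₗ[ℝ] ℝ) (hip : ∀ x y, ip x y = ip y x) (K : D →ₗ[ℝ] D)
    (hK : ∀ x y, ip (K x) y = ip x (K y)) {N : ℕ} (e : Fin N → D) (ev : Fin N → ℝ)
    (hon : ∀ i l, ip (e i) (e l) = if i = l then 1 else 0) (heig : ∀ j, K (e j) = ev j • e j) (x : D) (a : ℝ) (m : ℕ) :
    ip (K ((K : D → D)^[m] x) - a • (K : D → D)^[m] x) (K ((K : D → D)^[m] x) - a • (K : D → D)^[m] x) =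
      ∑ j, (ev j - a) ^ 2 * ev j ^ (2 * m) * ip x (e j) ^ 2 +
        ip (K ((K : D → D)^[m] (x - ∑ j, ip x (e j) • e j)) - a • (K : D → D)^[m] (x - ∑ j, ip x (e j) • e j))
          (K ((K : D → D)^[m] (x - ∑ j, ip x (e j) • e j)) - a • (K : D → D)^[m] (x - ∑ j, ip x (e j) • e j)) := by
  rw [residual_split ip hip K hK e ev hon heig ((K : D → D)^[m] x) a, iterate_remainder ip K hK e ev heig x m]
  congr 1
  refine sum_congr rfl fun j _ => ?_
  rw [ip_iterate_eigen ip K hK (heig j)]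
  ring

/-- **Gram split of the dressed vector**: `ip(K^[m]x, K^[m]x) = Σ_j λ_j^{2m} ip(x,e_j)² + ip(K^[m]r, K^[m]r)`. [cite: ReedSimonIV1978, Thm XIII.1] -/
theorem normSq_iterate_split (ip : D →ₗ[ℝ] D →ₗ[ℝ] ℝ) (hip : ∀ x y, ip x y = ip y x) (K : D →ₗ[ℝ] D)
    (hK : ∀ x y, ip (K x) y = ip x (K y)) {N : ℕ} (e : Fin N → D) (ev : Fin N → ℝ)
    (hon : ∀ i l, ip (e i) (e l) = if i = l then 1 else 0) (heig : ∀ j, K (e j) = ev j • e j) (x : D) (m : ℕ) :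
    ip ((K : D → D)^[m] x) ((K : D → D)^[m] x) =
      ∑ j, ev j ^ (2 * m) * ip x (e j) ^ 2 +
        ip ((K : D → D)^[m] (x - ∑ j, ip x (e j) • e j)) ((K : D → D)^[m] (x - ∑ j, ip x (e j) • e j)) := by
  rw [norm_split ip hip e hon ((K : D → D)^[m] x), iterate_remainder ip K hK e ev heig x m]
  congr 1
  refine sum_congr rfl fun j _ => ?_
  rw [ip_iterate_eigen ip K hK (heig j)]
  ring

/-- A `K`-stable class is stable under `K^[m]`. [folklore] -/
theorem iterate_mem_of_stable (K : D →ₗ[ℝ] D) (P : D → Prop) (hPK : ∀ y, P y → P (K y)) {r : D} (hr : P r) (m : ℕ) :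
    P ((K : D → D)^[m] r) := by
  induction m with
  | zero => simpa using hr
  | succ m ih => rw [Function.iterate_succ_apply']; exact hPK _ ih

/-- **Dressing a dominated remainder**: on a `K`-stable class `P` with `0 ≤ ip(y,Ky) ≤ Λ ip(y,y)` (`Λ ≥ 0`, `ip ≥ 0`):
`ip(K^[m]r, K^[m]r) ≤ Λ^{2m}·ip(r,r)` for `r ∈ P` (`K² ≤ Λ²` on the class, iterated). [cite: ReedSimonIV1978, Thm XIII.1] -/
theorem normSq_iterate_dom_le (ip : D →ₗ[ℝ] D →ₗ[ℝ] ℝ) (hip : ∀ x y, ip x y = ip y x) (hip0 : ∀ y, 0 ≤ ip y y)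
    (K : D →ₗ[ℝ] D) (hK : ∀ x y, ip (K x) y = ip x (K y)) (hpos : ∀ y, 0 ≤ ip y (K y))
    (P : D → Prop) (hPK : ∀ y, P y → P (K y)) {Λ : ℝ} (hΛ : 0 ≤ Λ) (hdom : ∀ y, P y → ip y (K y) ≤ Λ * ip y y)
    {r : D} (hr : P r) (m : ℕ) :
    ip ((K : D → D)^[m] r) ((K : D → D)^[m] r) ≤ Λ ^ (2 * m) * ip r r := by
  induction m with
  | zero => simp
  | succ m ih =>
    have hm : P ((K : D → D)^[m] r) := iterate_mem_of_stable K P hPK hr m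
    rw [Function.iterate_succ_apply']
    calc ip (K ((K : D → D)^[m] r)) (K ((K : D → D)^[m] r))
        ≤ Λ ^ 2 * ip ((K : D → D)^[m] r) ((K : D → D)^[m] r) := form_sq_le_dom_sq ip hip hip0 K hK hpos P hPK hΛ hdom hm
      _ ≤ Λ ^ 2 * (Λ ^ (2 * m) * ip r r) := mul_le_mul_of_nonneg_left ih (sq_nonneg _)
      _ = Λ ^ (2 * (m + 1)) * ip r r := by ring

/-- ★ **Dressed squared residual of a dominated remainder**: on the same class, for every `a` and `m`:
`ip((K−a)K^[m]r, (K−a)K^[m]r) ≤ max(a², (Λ−a)²)·Λ^{2m}·ip(r,r)`. [cite: ReedSimonIV1978, Thm XIII.1] -/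
theorem residual_iterate_remainder_le (ip : D →ₗ[ℝ] D →ₗ[ℝ] ℝ) (hip : ∀ x y, ip x y = ip y x) (hip0 : ∀ y, 0 ≤ ip y y)
    (K : D →ₗ[ℝ] D) (hK : ∀ x y, ip (K x) y = ip x (K y)) (hpos : ∀ y, 0 ≤ ip y (K y))
    (P : D → Prop) (hPK : ∀ y, P y → P (K y)) {Λ : ℝ} (hΛ : 0 ≤ Λ) (hdom : ∀ y, P y → ip y (K y) ≤ Λ * ip y y)
    {r : D} (hr : P r) (a : ℝ) (m : ℕ) :
    ip (K ((K : D → D)^[m] r) - a • (K : D → D)^[m] r) (K ((K : D → D)^[m] r) - a • (K : D → D)^[m] r) ≤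
      max (a ^ 2) ((Λ - a) ^ 2) * (Λ ^ (2 * m) * ip r r) := by
  have hm : P ((K : D → D)^[m] r) := iterate_mem_of_stable K P hPK hr m
  calc ip (K ((K : D → D)^[m] r) - a • (K : D → D)^[m] r) (K ((K : D → D)^[m] r) - a • (K : D → D)^[m] r)
      ≤ max (a ^ 2) ((Λ - a) ^ 2) * ip ((K : D → D)^[m] r) ((K : D → D)^[m] r) :=
        residual_remainder_le ip hip hip0 K hK hpos P hPK hΛ hdom hm a
    _ ≤ max (a ^ 2) ((Λ - a) ^ 2) * (Λ ^ (2 * m) * ip r r) :=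
        mul_le_mul_of_nonneg_left (normSq_iterate_dom_le ip hip hip0 K hK hpos P hPK hΛ hdom hr m)
          (le_max_of_le_left (sq_nonneg a))

end Abstract

end Summit.QuantumFields.YangMills.Theorems.FemtoTransferGap.LiftLeak

end
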